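import Mathlib
import Summits.KontsevichZagierPeriods.Zeta5Search.ClassTypeGuards
import Summits.KontsevichZagierPeriods.Zeta5Search.DenomLaw.PathAccountingShallow
import HarnessLib

/-!
# ζ(5) search — LEVEL KIT FOR A GENERAL SORTED PARAMETER VECTOR: net-exponent regions, typed-class constructors, `N_p = 21` on the full profile (DENOM-LAW D1, denom-prover-d1 g17)

HONEST FRAMING: systematic search; no irrationality claim unless certified.  Cell `pub-zeta5`, track «DENOM-LAW» D1, seat `denom-prover-d1`
gen 17 (`HOME/denom-law/prover-d1/ATTEMPT-17.md` §B).  The ray / family kits of the tree (`CellKitRays.depL_*`, `DenomLaw/TopFamilyCRLevels.ne_*`,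
`RuleRABFamilyLevels`, `XFamilyLevels`) compute the net exponents `netExp b q` of the Brown–Zudilin rational function `R_b` along the positions
`q ∈ [0, b₀]` for LINEAR families `b = bLin a e n`.  This file does the same for an ARBITRARY sorted vector `b` of the polytope (`InPolytope b`,
`Sorted7 b`: `b₁ ≥ b₂ ≥ … ≥ b₇`): the blocks `[b_j, b₀ − b_j]` are nested, so the depth of a position is read off its place among the fourteen
block ends — `1` below `b₇`, `1 − k` on the ascending step `[b_{8−k}, b_{7−k})`, `−6` in the well `[b₁, b₀ − b₁]` (off the even centre, `−5` at it),
`1 − k` on the descending step `(b₀ − b_{7−k}, b₀ − b_{8−k}]`, `1` above `b₀ − b₇` (`ne_low`, `ne_d1 … ne_d6`, `ne_well`, `ne_cen`, `ne_u6 … ne_u1`,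
`ne_high`; hypotheses as integer inequalities so that machine-generated covers discharge them by `omega`).  Plus: the typed-class constructors
`spType_ne / spType_eq` (`ClassTypeCover.isType_of_ne/eq` with integer side conditions), the parity flags `oddFlag_false/true`, and
**`pairFloors_eq_21`**: on the FULL PROFILE of the first period (the smallest pair block `b₀ − b₁ − b₂ ≥ p`, `FirstPeriod b p`) all 21 pair digits
are `1`.  Consumed by the machine-generated general-`b` covers `FullProfileCells*` and the assembly `DenomLaw/FullProfilePath` (PATH accounting on the
full profile for EVERY sorted `b`).  Integer bookkeeping; nothing about ζ(5); no γ; records in print UNMOVED.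
-/

open Finset

namespace Summit.KontsevichZagierPeriods.Zeta5Search.SortedProfile

open Summit.KontsevichZagierPeriods.Zeta5Search.ClusterValuation
open Summit.KontsevichZagierPeriods.Zeta5Search.CasoratianValuation (InPolytope pairFloors)
open Summit.KontsevichZagierPeriods.Zeta5Search.ClassTypeCover
open Summit.KontsevichZagierPeriods.Zeta5Search.BigPrime (block)
open Summit.KontsevichZagierPeriods.Zeta5Search.DenomLaw (Sorted7 FirstPeriod)
open Summit.KontsevichZagierPeriods.Zeta5Search.DenomLaw.FirstPeriodKit (sorted7_chain firstPeriod_pair pairFloors_expand)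

variable {b : ℕ → ℤ}

/-! ## §1 Block membership and the depth as an indicator sum -/

/-- Box facts of the polytope: all parameters are `≥ 0` and `2b₁ ≤ b₀`. -/
theorem box (hb : InPolytope b) :
    0 ≤ b 0 ∧ 0 ≤ b 1 ∧ 0 ≤ b 2 ∧ 0 ≤ b 3 ∧ 0 ≤ b 4 ∧ 0 ≤ b 5 ∧ 0 ≤ b 6 ∧ 0 ≤ b 7 ∧ 2 * b 1 ≤ b 0 :=
  ⟨hb.1.1, (hb.1.2 0 (by simp)).1, (hb.1.2 1 (by simp)).1, (hb.1.2 2 (by simp)).1, (hb.1.2 3 (by simp)).1,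
    (hb.1.2 4 (by simp)).1, (hb.1.2 5 (by simp)).1, (hb.1.2 6 (by simp)).1, hb.2.1 0 (by simp)⟩

/-- Membership of a position in the `j`-th block `[b_{j+1}, b₀ − b_{j+1}]`, as integer inequalities. -/
theorem mem_block_iff (hb : InPolytope b) (q j : ℕ) (hj : j < 7) :
    q ∈ block (b 0).toNat (b (j + 1)).toNat ↔ b (j + 1) ≤ (q : ℤ) ∧ (q : ℤ) + b (j + 1) ≤ b 0 := by
  have h0 : 0 ≤ b 0 := hb.1.1
  have hj' : 0 ≤ b (j + 1) := (hb.1.2 j (mem_range.2 hj)).1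
  obtain ⟨B, hB⟩ : ∃ B : ℕ, b 0 = (B : ℤ) := ⟨(b 0).toNat, (Int.toNat_of_nonneg h0).symm⟩
  obtain ⟨β, hβ⟩ : ∃ β : ℕ, b (j + 1) = (β : ℤ) := ⟨(b (j + 1)).toNat, (Int.toNat_of_nonneg hj').symm⟩
  rw [hB, hβ, Int.toNat_natCast, Int.toNat_natCast]
  simp only [block, mem_Icc]
  omega

/-- **The depth of a position as an indicator sum over the seven blocks.** -/
theorem blockCount_eq_sum (hb : InPolytope b) (q : ℕ) :
    (blockCount b q : ℤ) = ∑ j ∈ range 7, (if b (j + 1) ≤ (q : ℤ) ∧ (q : ℤ) + b (j + 1) ≤ b 0 then (1 : ℤ) else 0) := by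
  unfold blockCount
  rw [card_filter]
  push_cast
  exact sum_congr rfl fun j hj => if_congr (mem_block_iff hb q j (mem_range.1 hj)) rfl rfl

/-- **Net exponent of a position**, written out: `1 − Σ_j [q ∈ block_j] + [2q = b₀]`. -/
theorem netExp_eq (hb : InPolytope b) (q : ℕ) : netExp b q =
    1 - ((if b 1 ≤ (q : ℤ) ∧ (q : ℤ) + b 1 ≤ b 0 then (1 : ℤ) else 0) + (if b 2 ≤ (q : ℤ) ∧ (q : ℤ) + b 2 ≤ b 0 then (1 : ℤ) else 0)
      + (if b 3 ≤ (q : ℤ) ∧ (q : ℤ) + b 3 ≤ b 0 then (1 : ℤ) else 0) + (if b 4 ≤ (q : ℤ) ∧ (q : ℤ) + b 4 ≤ b 0 then (1 : ℤ) else 0)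
      + (if b 5 ≤ (q : ℤ) ∧ (q : ℤ) + b 5 ≤ b 0 then (1 : ℤ) else 0) + (if b 6 ≤ (q : ℤ) ∧ (q : ℤ) + b 6 ≤ b 0 then (1 : ℤ) else 0)
      + (if b 7 ≤ (q : ℤ) ∧ (q : ℤ) + b 7 ≤ b 0 then (1 : ℤ) else 0))
      + (if 2 * (q : ℤ) = b 0 then 1 else 0) := by
  unfold netExp
  rw [blockCount_eq_sum hb]
  simp only [sum_range_succ, sum_range_zero, zero_add, Nat.reduceAdd]

/-! ## §2 The fifteen regions of a sorted vector -/

section Regions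

variable (hb : InPolytope b) (hs : Sorted7 b) {q : ℕ}
include hb hs

/-- Below every block (`q < b₇`): net exponent `1`. -/
theorem ne_low (h : (q : ℤ) < b 7) : netExp b q = 1 := by
  obtain ⟨h21, h32, h43, h54, h65, h76⟩ := sorted7_chain hs
  obtain ⟨h0, hb1, hb2, hb3, hb4, hb5, hb6, hb7, hc1⟩ := box hb
  rw [netExp_eq hb, if_neg (show ¬ (b 1 ≤ (q : ℤ) ∧ (q : ℤ) + b 1 ≤ b 0) by omega),
    if_neg (show ¬ (b 2 ≤ (q : ℤ) ∧ (q : ℤ) + b 2 ≤ b 0) by omega),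
    if_neg (show ¬ (b 3 ≤ (q : ℤ) ∧ (q : ℤ) + b 3 ≤ b 0) by omega),
    if_neg (show ¬ (b 4 ≤ (q : ℤ) ∧ (q : ℤ) + b 4 ≤ b 0) by omega),
    if_neg (show ¬ (b 5 ≤ (q : ℤ) ∧ (q : ℤ) + b 5 ≤ b 0) by omega),
    if_neg (show ¬ (b 6 ≤ (q : ℤ) ∧ (q : ℤ) + b 6 ≤ b 0) by omega),
    if_neg (show ¬ (b 7 ≤ (q : ℤ) ∧ (q : ℤ) + b 7 ≤ b 0) by omega),
    if_neg (show ¬ (2 * (q : ℤ) = b 0) by omega)]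
  norm_num

/-- Ascending step `d1`: `b_7 ≤ q < b_6` (depth 1): net exponent `0`. -/
theorem ne_d1 (h : b 7 ≤ (q : ℤ) ∧ (q : ℤ) < b 6) : netExp b q = 0 := by
  obtain ⟨h21, h32, h43, h54, h65, h76⟩ := sorted7_chain hs
  obtain ⟨h0, hb1, hb2, hb3, hb4, hb5, hb6, hb7, hc1⟩ := box hb
  rw [netExp_eq hb, if_neg (show ¬ (b 1 ≤ (q : ℤ) ∧ (q : ℤ) + b 1 ≤ b 0) by omega),
    if_neg (show ¬ (b 2 ≤ (q : ℤ) ∧ (q : ℤ) + b 2 ≤ b 0) by omega),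
    if_neg (show ¬ (b 3 ≤ (q : ℤ) ∧ (q : ℤ) + b 3 ≤ b 0) by omega),
    if_neg (show ¬ (b 4 ≤ (q : ℤ) ∧ (q : ℤ) + b 4 ≤ b 0) by omega),
    if_neg (show ¬ (b 5 ≤ (q : ℤ) ∧ (q : ℤ) + b 5 ≤ b 0) by omega),
    if_neg (show ¬ (b 6 ≤ (q : ℤ) ∧ (q : ℤ) + b 6 ≤ b 0) by omega),
    if_pos (show b 7 ≤ (q : ℤ) ∧ (q : ℤ) + b 7 ≤ b 0 by omega),
    if_neg (show ¬ (2 * (q : ℤ) = b 0) by omega)]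
  norm_num

/-- Ascending step `d2`: `b_6 ≤ q < b_5` (depth 2): net exponent `-1`. -/
theorem ne_d2 (h : b 6 ≤ (q : ℤ) ∧ (q : ℤ) < b 5) : netExp b q = -1 := by
  obtain ⟨h21, h32, h43, h54, h65, h76⟩ := sorted7_chain hs
  obtain ⟨h0, hb1, hb2, hb3, hb4, hb5, hb6, hb7, hc1⟩ := box hb
  rw [netExp_eq hb, if_neg (show ¬ (b 1 ≤ (q : ℤ) ∧ (q : ℤ) + b 1 ≤ b 0) by omega),
    if_neg (show ¬ (b 2 ≤ (q : ℤ) ∧ (q : ℤ) + b 2 ≤ b 0) by omega),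
    if_neg (show ¬ (b 3 ≤ (q : ℤ) ∧ (q : ℤ) + b 3 ≤ b 0) by omega),
    if_neg (show ¬ (b 4 ≤ (q : ℤ) ∧ (q : ℤ) + b 4 ≤ b 0) by omega),
    if_neg (show ¬ (b 5 ≤ (q : ℤ) ∧ (q : ℤ) + b 5 ≤ b 0) by omega),
    if_pos (show b 6 ≤ (q : ℤ) ∧ (q : ℤ) + b 6 ≤ b 0 by omega),
    if_pos (show b 7 ≤ (q : ℤ) ∧ (q : ℤ) + b 7 ≤ b 0 by omega),
    if_neg (show ¬ (2 * (q : ℤ) = b 0) by omega)]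
  norm_num

/-- Ascending step `d3`: `b_5 ≤ q < b_4` (depth 3): net exponent `-2`. -/
theorem ne_d3 (h : b 5 ≤ (q : ℤ) ∧ (q : ℤ) < b 4) : netExp b q = -2 := by
  obtain ⟨h21, h32, h43, h54, h65, h76⟩ := sorted7_chain hs
  obtain ⟨h0, hb1, hb2, hb3, hb4, hb5, hb6, hb7, hc1⟩ := box hb
  rw [netExp_eq hb, if_neg (show ¬ (b 1 ≤ (q : ℤ) ∧ (q : ℤ) + b 1 ≤ b 0) by omega),
    if_neg (show ¬ (b 2 ≤ (q : ℤ) ∧ (q : ℤ) + b 2 ≤ b 0) by omega),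
    if_neg (show ¬ (b 3 ≤ (q : ℤ) ∧ (q : ℤ) + b 3 ≤ b 0) by omega),
    if_neg (show ¬ (b 4 ≤ (q : ℤ) ∧ (q : ℤ) + b 4 ≤ b 0) by omega),
    if_pos (show b 5 ≤ (q : ℤ) ∧ (q : ℤ) + b 5 ≤ b 0 by omega),
    if_pos (show b 6 ≤ (q : ℤ) ∧ (q : ℤ) + b 6 ≤ b 0 by omega),
    if_pos (show b 7 ≤ (q : ℤ) ∧ (q : ℤ) + b 7 ≤ b 0 by omega),
    if_neg (show ¬ (2 * (q : ℤ) = b 0) by omega)]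
  norm_num

/-- Ascending step `d4`: `b_4 ≤ q < b_3` (depth 4): net exponent `-3`. -/
theorem ne_d4 (h : b 4 ≤ (q : ℤ) ∧ (q : ℤ) < b 3) : netExp b q = -3 := by
  obtain ⟨h21, h32, h43, h54, h65, h76⟩ := sorted7_chain hs
  obtain ⟨h0, hb1, hb2, hb3, hb4, hb5, hb6, hb7, hc1⟩ := box hb
  rw [netExp_eq hb, if_neg (show ¬ (b 1 ≤ (q : ℤ) ∧ (q : ℤ) + b 1 ≤ b 0) by omega),
    if_neg (show ¬ (b 2 ≤ (q : ℤ) ∧ (q : ℤ) + b 2 ≤ b 0) by omega),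
    if_neg (show ¬ (b 3 ≤ (q : ℤ) ∧ (q : ℤ) + b 3 ≤ b 0) by omega),
    if_pos (show b 4 ≤ (q : ℤ) ∧ (q : ℤ) + b 4 ≤ b 0 by omega),
    if_pos (show b 5 ≤ (q : ℤ) ∧ (q : ℤ) + b 5 ≤ b 0 by omega),
    if_pos (show b 6 ≤ (q : ℤ) ∧ (q : ℤ) + b 6 ≤ b 0 by omega),
    if_pos (show b 7 ≤ (q : ℤ) ∧ (q : ℤ) + b 7 ≤ b 0 by omega),
    if_neg (show ¬ (2 * (q : ℤ) = b 0) by omega)]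
  norm_num

/-- Ascending step `d5`: `b_3 ≤ q < b_2` (depth 5): net exponent `-4`. -/
theorem ne_d5 (h : b 3 ≤ (q : ℤ) ∧ (q : ℤ) < b 2) : netExp b q = -4 := by
  obtain ⟨h21, h32, h43, h54, h65, h76⟩ := sorted7_chain hs
  obtain ⟨h0, hb1, hb2, hb3, hb4, hb5, hb6, hb7, hc1⟩ := box hb
  rw [netExp_eq hb, if_neg (show ¬ (b 1 ≤ (q : ℤ) ∧ (q : ℤ) + b 1 ≤ b 0) by omega),
    if_neg (show ¬ (b 2 ≤ (q : ℤ) ∧ (q : ℤ) + b 2 ≤ b 0) by omega),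
    if_pos (show b 3 ≤ (q : ℤ) ∧ (q : ℤ) + b 3 ≤ b 0 by omega),
    if_pos (show b 4 ≤ (q : ℤ) ∧ (q : ℤ) + b 4 ≤ b 0 by omega),
    if_pos (show b 5 ≤ (q : ℤ) ∧ (q : ℤ) + b 5 ≤ b 0 by omega),
    if_pos (show b 6 ≤ (q : ℤ) ∧ (q : ℤ) + b 6 ≤ b 0 by omega),
    if_pos (show b 7 ≤ (q : ℤ) ∧ (q : ℤ) + b 7 ≤ b 0 by omega),
    if_neg (show ¬ (2 * (q : ℤ) = b 0) by omega)]
  norm_num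

/-- Ascending step `d6`: `b_2 ≤ q < b_1` (depth 6): net exponent `-5`. -/
theorem ne_d6 (h : b 2 ≤ (q : ℤ) ∧ (q : ℤ) < b 1) : netExp b q = -5 := by
  obtain ⟨h21, h32, h43, h54, h65, h76⟩ := sorted7_chain hs
  obtain ⟨h0, hb1, hb2, hb3, hb4, hb5, hb6, hb7, hc1⟩ := box hb
  rw [netExp_eq hb, if_neg (show ¬ (b 1 ≤ (q : ℤ) ∧ (q : ℤ) + b 1 ≤ b 0) by omega),
    if_pos (show b 2 ≤ (q : ℤ) ∧ (q : ℤ) + b 2 ≤ b 0 by omega),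
    if_pos (show b 3 ≤ (q : ℤ) ∧ (q : ℤ) + b 3 ≤ b 0 by omega),
    if_pos (show b 4 ≤ (q : ℤ) ∧ (q : ℤ) + b 4 ≤ b 0 by omega),
    if_pos (show b 5 ≤ (q : ℤ) ∧ (q : ℤ) + b 5 ≤ b 0 by omega),
    if_pos (show b 6 ≤ (q : ℤ) ∧ (q : ℤ) + b 6 ≤ b 0 by omega),
    if_pos (show b 7 ≤ (q : ℤ) ∧ (q : ℤ) + b 7 ≤ b 0 by omega),
    if_neg (show ¬ (2 * (q : ℤ) = b 0) by omega)]
  norm_num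

/-- The well `b₁ ≤ q ≤ b₀ − b₁` off the centre (depth 7): net exponent `-6`. -/
theorem ne_well (h : b 1 ≤ (q : ℤ) ∧ (q : ℤ) + b 1 ≤ b 0 ∧ 2 * (q : ℤ) ≠ b 0) : netExp b q = -6 := by
  obtain ⟨h21, h32, h43, h54, h65, h76⟩ := sorted7_chain hs
  obtain ⟨h0, hb1, hb2, hb3, hb4, hb5, hb6, hb7, hc1⟩ := box hb
  rw [netExp_eq hb, if_pos (show b 1 ≤ (q : ℤ) ∧ (q : ℤ) + b 1 ≤ b 0 by omega),
    if_pos (show b 2 ≤ (q : ℤ) ∧ (q : ℤ) + b 2 ≤ b 0 by omega),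
    if_pos (show b 3 ≤ (q : ℤ) ∧ (q : ℤ) + b 3 ≤ b 0 by omega),
    if_pos (show b 4 ≤ (q : ℤ) ∧ (q : ℤ) + b 4 ≤ b 0 by omega),
    if_pos (show b 5 ≤ (q : ℤ) ∧ (q : ℤ) + b 5 ≤ b 0 by omega),
    if_pos (show b 6 ≤ (q : ℤ) ∧ (q : ℤ) + b 6 ≤ b 0 by omega),
    if_pos (show b 7 ≤ (q : ℤ) ∧ (q : ℤ) + b 7 ≤ b 0 by omega),
    if_neg (show ¬ (2 * (q : ℤ) = b 0) by omega)]
  norm_num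

/-- The even centre `2q = b₀` (depth 7, merged zero of the very-well-poised factor): net exponent `-5`. -/
theorem ne_cen (h : 2 * (q : ℤ) = b 0) : netExp b q = -5 := by
  obtain ⟨h21, h32, h43, h54, h65, h76⟩ := sorted7_chain hs
  obtain ⟨h0, hb1, hb2, hb3, hb4, hb5, hb6, hb7, hc1⟩ := box hb
  rw [netExp_eq hb, if_pos (show b 1 ≤ (q : ℤ) ∧ (q : ℤ) + b 1 ≤ b 0 by omega),
    if_pos (show b 2 ≤ (q : ℤ) ∧ (q : ℤ) + b 2 ≤ b 0 by omega),
    if_pos (show b 3 ≤ (q : ℤ) ∧ (q : ℤ) + b 3 ≤ b 0 by omega),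
    if_pos (show b 4 ≤ (q : ℤ) ∧ (q : ℤ) + b 4 ≤ b 0 by omega),
    if_pos (show b 5 ≤ (q : ℤ) ∧ (q : ℤ) + b 5 ≤ b 0 by omega),
    if_pos (show b 6 ≤ (q : ℤ) ∧ (q : ℤ) + b 6 ≤ b 0 by omega),
    if_pos (show b 7 ≤ (q : ℤ) ∧ (q : ℤ) + b 7 ≤ b 0 by omega),
    if_pos (show 2 * (q : ℤ) = b 0 by omega)]
  norm_num

/-- Descending step `u6`: `b₀ − b_1 < q ≤ b₀ − b_2` (depth 6): net exponent `-5`. -/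
theorem ne_u6 (h : b 0 < (q : ℤ) + b 1 ∧ (q : ℤ) + b 2 ≤ b 0) : netExp b q = -5 := by
  obtain ⟨h21, h32, h43, h54, h65, h76⟩ := sorted7_chain hs
  obtain ⟨h0, hb1, hb2, hb3, hb4, hb5, hb6, hb7, hc1⟩ := box hb
  rw [netExp_eq hb, if_neg (show ¬ (b 1 ≤ (q : ℤ) ∧ (q : ℤ) + b 1 ≤ b 0) by omega),
    if_pos (show b 2 ≤ (q : ℤ) ∧ (q : ℤ) + b 2 ≤ b 0 by omega),
    if_pos (show b 3 ≤ (q : ℤ) ∧ (q : ℤ) + b 3 ≤ b 0 by omega),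
    if_pos (show b 4 ≤ (q : ℤ) ∧ (q : ℤ) + b 4 ≤ b 0 by omega),
    if_pos (show b 5 ≤ (q : ℤ) ∧ (q : ℤ) + b 5 ≤ b 0 by omega),
    if_pos (show b 6 ≤ (q : ℤ) ∧ (q : ℤ) + b 6 ≤ b 0 by omega),
    if_pos (show b 7 ≤ (q : ℤ) ∧ (q : ℤ) + b 7 ≤ b 0 by omega),
    if_neg (show ¬ (2 * (q : ℤ) = b 0) by omega)]
  norm_num

/-- Descending step `u5`: `b₀ − b_2 < q ≤ b₀ − b_3` (depth 5): net exponent `-4`. -/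
theorem ne_u5 (h : b 0 < (q : ℤ) + b 2 ∧ (q : ℤ) + b 3 ≤ b 0) : netExp b q = -4 := by
  obtain ⟨h21, h32, h43, h54, h65, h76⟩ := sorted7_chain hs
  obtain ⟨h0, hb1, hb2, hb3, hb4, hb5, hb6, hb7, hc1⟩ := box hb
  rw [netExp_eq hb, if_neg (show ¬ (b 1 ≤ (q : ℤ) ∧ (q : ℤ) + b 1 ≤ b 0) by omega),
    if_neg (show ¬ (b 2 ≤ (q : ℤ) ∧ (q : ℤ) + b 2 ≤ b 0) by omega),
    if_pos (show b 3 ≤ (q : ℤ) ∧ (q : ℤ) + b 3 ≤ b 0 by omega),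
    if_pos (show b 4 ≤ (q : ℤ) ∧ (q : ℤ) + b 4 ≤ b 0 by omega),
    if_pos (show b 5 ≤ (q : ℤ) ∧ (q : ℤ) + b 5 ≤ b 0 by omega),
    if_pos (show b 6 ≤ (q : ℤ) ∧ (q : ℤ) + b 6 ≤ b 0 by omega),
    if_pos (show b 7 ≤ (q : ℤ) ∧ (q : ℤ) + b 7 ≤ b 0 by omega),
    if_neg (show ¬ (2 * (q : ℤ) = b 0) by omega)]
  norm_num

/-- Descending step `u4`: `b₀ − b_3 < q ≤ b₀ − b_4` (depth 4): net exponent `-3`. -/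
theorem ne_u4 (h : b 0 < (q : ℤ) + b 3 ∧ (q : ℤ) + b 4 ≤ b 0) : netExp b q = -3 := by
  obtain ⟨h21, h32, h43, h54, h65, h76⟩ := sorted7_chain hs
  obtain ⟨h0, hb1, hb2, hb3, hb4, hb5, hb6, hb7, hc1⟩ := box hb
  rw [netExp_eq hb, if_neg (show ¬ (b 1 ≤ (q : ℤ) ∧ (q : ℤ) + b 1 ≤ b 0) by omega),
    if_neg (show ¬ (b 2 ≤ (q : ℤ) ∧ (q : ℤ) + b 2 ≤ b 0) by omega),
    if_neg (show ¬ (b 3 ≤ (q : ℤ) ∧ (q : ℤ) + b 3 ≤ b 0) by omega),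
    if_pos (show b 4 ≤ (q : ℤ) ∧ (q : ℤ) + b 4 ≤ b 0 by omega),
    if_pos (show b 5 ≤ (q : ℤ) ∧ (q : ℤ) + b 5 ≤ b 0 by omega),
    if_pos (show b 6 ≤ (q : ℤ) ∧ (q : ℤ) + b 6 ≤ b 0 by omega),
    if_pos (show b 7 ≤ (q : ℤ) ∧ (q : ℤ) + b 7 ≤ b 0 by omega),
    if_neg (show ¬ (2 * (q : ℤ) = b 0) by omega)]
  norm_num

/-- Descending step `u3`: `b₀ − b_4 < q ≤ b₀ − b_5` (depth 3): net exponent `-2`. -/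
theorem ne_u3 (h : b 0 < (q : ℤ) + b 4 ∧ (q : ℤ) + b 5 ≤ b 0) : netExp b q = -2 := by
  obtain ⟨h21, h32, h43, h54, h65, h76⟩ := sorted7_chain hs
  obtain ⟨h0, hb1, hb2, hb3, hb4, hb5, hb6, hb7, hc1⟩ := box hb
  rw [netExp_eq hb, if_neg (show ¬ (b 1 ≤ (q : ℤ) ∧ (q : ℤ) + b 1 ≤ b 0) by omega),
    if_neg (show ¬ (b 2 ≤ (q : ℤ) ∧ (q : ℤ) + b 2 ≤ b 0) by omega),
    if_neg (show ¬ (b 3 ≤ (q : ℤ) ∧ (q : ℤ) + b 3 ≤ b 0) by omega),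
    if_neg (show ¬ (b 4 ≤ (q : ℤ) ∧ (q : ℤ) + b 4 ≤ b 0) by omega),
    if_pos (show b 5 ≤ (q : ℤ) ∧ (q : ℤ) + b 5 ≤ b 0 by omega),
    if_pos (show b 6 ≤ (q : ℤ) ∧ (q : ℤ) + b 6 ≤ b 0 by omega),
    if_pos (show b 7 ≤ (q : ℤ) ∧ (q : ℤ) + b 7 ≤ b 0 by omega),
    if_neg (show ¬ (2 * (q : ℤ) = b 0) by omega)]
  norm_num

/-- Descending step `u2`: `b₀ − b_5 < q ≤ b₀ − b_6` (depth 2): net exponent `-1`. -/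
theorem ne_u2 (h : b 0 < (q : ℤ) + b 5 ∧ (q : ℤ) + b 6 ≤ b 0) : netExp b q = -1 := by
  obtain ⟨h21, h32, h43, h54, h65, h76⟩ := sorted7_chain hs
  obtain ⟨h0, hb1, hb2, hb3, hb4, hb5, hb6, hb7, hc1⟩ := box hb
  rw [netExp_eq hb, if_neg (show ¬ (b 1 ≤ (q : ℤ) ∧ (q : ℤ) + b 1 ≤ b 0) by omega),
    if_neg (show ¬ (b 2 ≤ (q : ℤ) ∧ (q : ℤ) + b 2 ≤ b 0) by omega),
    if_neg (show ¬ (b 3 ≤ (q : ℤ) ∧ (q : ℤ) + b 3 ≤ b 0) by omega),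
    if_neg (show ¬ (b 4 ≤ (q : ℤ) ∧ (q : ℤ) + b 4 ≤ b 0) by omega),
    if_neg (show ¬ (b 5 ≤ (q : ℤ) ∧ (q : ℤ) + b 5 ≤ b 0) by omega),
    if_pos (show b 6 ≤ (q : ℤ) ∧ (q : ℤ) + b 6 ≤ b 0 by omega),
    if_pos (show b 7 ≤ (q : ℤ) ∧ (q : ℤ) + b 7 ≤ b 0 by omega),
    if_neg (show ¬ (2 * (q : ℤ) = b 0) by omega)]
  norm_num

/-- Descending step `u1`: `b₀ − b_6 < q ≤ b₀ − b_7` (depth 1): net exponent `0`. -/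
theorem ne_u1 (h : b 0 < (q : ℤ) + b 6 ∧ (q : ℤ) + b 7 ≤ b 0) : netExp b q = 0 := by
  obtain ⟨h21, h32, h43, h54, h65, h76⟩ := sorted7_chain hs
  obtain ⟨h0, hb1, hb2, hb3, hb4, hb5, hb6, hb7, hc1⟩ := box hb
  rw [netExp_eq hb, if_neg (show ¬ (b 1 ≤ (q : ℤ) ∧ (q : ℤ) + b 1 ≤ b 0) by omega),
    if_neg (show ¬ (b 2 ≤ (q : ℤ) ∧ (q : ℤ) + b 2 ≤ b 0) by omega),
    if_neg (show ¬ (b 3 ≤ (q : ℤ) ∧ (q : ℤ) + b 3 ≤ b 0) by omega),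
    if_neg (show ¬ (b 4 ≤ (q : ℤ) ∧ (q : ℤ) + b 4 ≤ b 0) by omega),
    if_neg (show ¬ (b 5 ≤ (q : ℤ) ∧ (q : ℤ) + b 5 ≤ b 0) by omega),
    if_neg (show ¬ (b 6 ≤ (q : ℤ) ∧ (q : ℤ) + b 6 ≤ b 0) by omega),
    if_pos (show b 7 ≤ (q : ℤ) ∧ (q : ℤ) + b 7 ≤ b 0 by omega),
    if_neg (show ¬ (2 * (q : ℤ) = b 0) by omega)]
  norm_num

/-- Above every block (`q > b₀ − b₇`): net exponent `1`. -/
theorem ne_high (h : b 0 < (q : ℤ) + b 7) : netExp b q = 1 := by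
  obtain ⟨h21, h32, h43, h54, h65, h76⟩ := sorted7_chain hs
  obtain ⟨h0, hb1, hb2, hb3, hb4, hb5, hb6, hb7, hc1⟩ := box hb
  rw [netExp_eq hb, if_neg (show ¬ (b 1 ≤ (q : ℤ) ∧ (q : ℤ) + b 1 ≤ b 0) by omega),
    if_neg (show ¬ (b 2 ≤ (q : ℤ) ∧ (q : ℤ) + b 2 ≤ b 0) by omega),
    if_neg (show ¬ (b 3 ≤ (q : ℤ) ∧ (q : ℤ) + b 3 ≤ b 0) by omega),
    if_neg (show ¬ (b 4 ≤ (q : ℤ) ∧ (q : ℤ) + b 4 ≤ b 0) by omega),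
    if_neg (show ¬ (b 5 ≤ (q : ℤ) ∧ (q : ℤ) + b 5 ≤ b 0) by omega),
    if_neg (show ¬ (b 6 ≤ (q : ℤ) ∧ (q : ℤ) + b 6 ≤ b 0) by omega),
    if_neg (show ¬ (b 7 ≤ (q : ℤ) ∧ (q : ℤ) + b 7 ≤ b 0) by omega),
    if_neg (show ¬ (2 * (q : ℤ) = b 0) by omega)]
  norm_num

end Regions

/-! ## §3 Typed classes and parity flags for a general vector -/

variable {p : ℕ} [Fact p.Prime]

/-- Constructor of a non-self-conjugate typed level class (`ClassTypeCover.isType_of_ne` with integer side conditions). -/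
theorem spType_ne (hb : InPolytope b) {x : ℕ} (L : ℕ) {T : List ℤ} (hlen : T.length = L + 1) (hx : x < p)
    (hL : (x : ℤ) + L * p ≤ b 0) (hL' : b 0 < (x : ℤ) + L * p + p) (hlev : Levels b x p T)
    (hne : 2 * (x : ℤ) + L * p ≠ b 0) : IsType b p x T false := by
  have h0 : 0 ≤ b 0 := hb.1.1
  have e : (((b 0).toNat : ℕ) : ℤ) = b 0 := Int.toNat_of_nonneg h0
  exact isType_of_ne h0 L hlen hx (by clear hne hL'; omega) (by clear hne hL; omega) hlev (by omega)

/-- Constructor of the self-conjugate typed level class (`2x + Lp = b₀`). -/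
theorem spType_eq (hb : InPolytope b) {x : ℕ} (L : ℕ) {T : List ℤ} (hlen : T.length = L + 1) (hx : x < p)
    (hL : (x : ℤ) + L * p ≤ b 0) (hL' : b 0 < (x : ℤ) + L * p + p) (hlev : Levels b x p T)
    (heq : 2 * (x : ℤ) + L * p = b 0) : IsType b p x T true := by
  have h0 : 0 ≤ b 0 := hb.1.1
  have e : (((b 0).toNat : ℕ) : ℤ) = b 0 := Int.toNat_of_nonneg h0
  exact isType_of_eq h0 L hlen hx (by clear heq hL'; omega) (by clear heq hL; omega) hlev (by omega)

omit [Fact p.Prime] in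
/-- The parity flag of an even `b₀`. -/
theorem oddFlag_false (h : b 0 % 2 = 0) : decide (¬ (2 : ℤ) ∣ b 0) = false := by
  rw [decide_eq_false_iff_not, not_not]
  exact Int.dvd_of_emod_eq_zero h

omit [Fact p.Prime] in
/-- The parity flag of an odd `b₀`. -/
theorem oddFlag_true (h : b 0 % 2 = 1) : decide (¬ (2 : ℤ) ∣ b 0) = true := by
  rw [decide_eq_true_iff]
  rintro ⟨c, hc⟩
  omega

/-! ## §4 `N_p = 21` on the full profile of the first period -/

omit [Fact p.Prime] in
/-- **All 21 pair digits are `1` on the full profile**: if the smallest pair block `b₀ − b₁ − b₂` reaches `p` and all 28 forms are `< 2p`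
(`FirstPeriod`), then `pairFloors b p = 21`. -/
theorem pairFloors_eq_21 (hs : Sorted7 b) (hp : 0 < p) (hQ : (p : ℤ) ≤ b 0 - b 1 - b 2) (hfp : FirstPeriod b p) :
    pairFloors b p = 21 := by
  obtain ⟨h21, h32, h43, h54, h65, h76⟩ := sorted7_chain hs
  have hp0 : (0 : ℤ) < p := by exact_mod_cast hp
  have one : ∀ z : ℤ, (p : ℤ) ≤ z → z ≤ 2 * (p : ℤ) - 1 → z / (p : ℤ) = 1 := fun z h1 h2 => by
    rw [Int.ediv_eq_iff_of_pos hp0]; constructor <;> linarith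
  have U := fun (i k : ℕ) (hi : i < 7) (hk : k < 7) (hik : i < k) => firstPeriod_pair hfp hi hk hik
  rw [pairFloors_expand,
    one _ (by linarith) (U 0 1 (by norm_num) (by norm_num) (by norm_num)), one _ (by linarith) (U 0 2 (by norm_num) (by norm_num) (by norm_num)),
    one _ (by linarith) (U 0 3 (by norm_num) (by norm_num) (by norm_num)), one _ (by linarith) (U 0 4 (by norm_num) (by norm_num) (by norm_num)),
    one _ (by linarith) (U 0 5 (by norm_num) (by norm_num) (by norm_num)), one _ (by linarith) (U 0 6 (by norm_num) (by norm_num) (by norm_num)),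
    one _ (by linarith) (U 1 2 (by norm_num) (by norm_num) (by norm_num)), one _ (by linarith) (U 1 3 (by norm_num) (by norm_num) (by norm_num)),
    one _ (by linarith) (U 1 4 (by norm_num) (by norm_num) (by norm_num)), one _ (by linarith) (U 1 5 (by norm_num) (by norm_num) (by norm_num)),
    one _ (by linarith) (U 1 6 (by norm_num) (by norm_num) (by norm_num)), one _ (by linarith) (U 2 3 (by norm_num) (by norm_num) (by norm_num)),
    one _ (by linarith) (U 2 4 (by norm_num) (by norm_num) (by norm_num)), one _ (by linarith) (U 2 5 (by norm_num) (by norm_num) (by norm_num)),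
    one _ (by linarith) (U 2 6 (by norm_num) (by norm_num) (by norm_num)), one _ (by linarith) (U 3 4 (by norm_num) (by norm_num) (by norm_num)),
    one _ (by linarith) (U 3 5 (by norm_num) (by norm_num) (by norm_num)), one _ (by linarith) (U 3 6 (by norm_num) (by norm_num) (by norm_num)),
    one _ (by linarith) (U 4 5 (by norm_num) (by norm_num) (by norm_num)), one _ (by linarith) (U 4 6 (by norm_num) (by norm_num) (by norm_num)),
    one _ (by linarith) (U 5 6 (by norm_num) (by norm_num) (by norm_num))]
  norm_num

end Summit.KontsevichZagierPeriods.Zeta5Search.SortedProfile
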